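import Summits.BirchSwinnertonDyer.BirchSwinnertonDyer.Theorems.ByReductionTypeAtTwoFineSelmerConjAAtTwoAdditivePotGoodAscentStampsA
import HarnessLib

/-!
# C4″ `AdditivePotMultOverKAtTwo` (item stmt-BirchSwinnertonDyer-22618), the (I1M′) input of the upper half on the `Δ < 0` rows:
# KERNEL STAMPS, part K — Iwasawa's `μ₂ = 0` (ZERO hypotheses) for the `2`-torsion cubic fields `d = -5960`, `d = -4232` and UNCONDITIONAL
# statement (A) at `2` for the C4″ census curves 333760ct1, 296240dt1

Cell `bsd-2adic`, rung K4, seat `bsd-2adic-k4-w3` GEN 11 (explicit unit of director-bsd g16 (309)(7); `--supports stmt-BirchSwinnertonDyer-22618`).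
HONEST FRAMING (D-0036/D-0054/D-0152): THEOREMS ONLY (no definition, no named fact, no `sorry`). FIELD PART (unconditional kernel arithmetic about an
explicit cubic field `ℚ(θ)`; generator = eng-2's polredabs cubic when its index `[𝓞 : ℤ[θ]]` is odd, else an odd-index second generator):
`irreducible_cubic_<d>`, `odd_classNumber_of_root_<d>` (norm certificate below the Minkowski bound; k4-w1's `odd_classNumber_of_cubeCertificate`),
**`classicalMu_two_cubicField_<d>`** = `μ = 0` (growth form) along EVERY cyclotomic `ℤ₂`-extension of `ℚ(θ)` from `e₀ = 0` (odd `h`), `e₁ = 0` (k4-w1's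
Chevalley door at `2`, `layerOneBit_of_chevalleyCert`: a unit with `2`-adic image `≡ ±3 (mod 8)` is not a norm from `ℚ(θ, √2)`; ≤ 2 primes above `2`),
`n₀ = 0` (odd cubic discriminant `…_of_odd_cubic_discr`, or `2 = 𝔭𝔮²` with an even-index certificate `…_of_evenIndexCertificate`) and Fukuda 1994 Thm. 1 (1)
(`_holds`). These fields have TWO primes above `2` (the `2`-division cubic of a potentially multiplicative curve has a `ℚ₂`-root). ROW PART:
`conjA_two_<L>'` = Coates–Sujatha's statement (A) at `p = 2` for the census cubic model of the Cremona class (a-invariants of addL2x GEN 13's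
`nst_census-j313647.tsv`), PROVED OUTRIGHT: field identification `ℚ(β) = ℚ(θ)` + cruxlead-19573-w2's door
`TotallyComplexMu.conjA_two_cubicModel_of_classicalMu_of_discr_neg` (kernel Lim 3.5@2 + `ℓ = 2` ascent). Certificates (norm witnesses, fundamental units by a
relation sieve, Hensel data, even-index elements) found by the seat's exact-arithmetic tools (`work/tools/`) and CHECKED HERE by the kernel; eng-2's
census CERT-ADD-POTMULT-FUKUDA269-E2 agrees (`μ₂ = λ₂ = 0`, bnfcertify). Statement (A) is NOT BSD: BSD₂ for these curves is not proved; C4″ / (I1M′) stay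
research-open; nothing booked; no row of 22618 changes tier (pen RC-490 (4)). Pattern/toolkit: k4-w1 GEN 5–8 (`…MuTwoKernelRows{A,B}`, `…AscentStampsA`).

References: [CoatesSujatha2005] Conj. A, Thm. 3.4; [Iwasawa1973MuInvariants] Thm. 2/3; [Fukuda1994] Thm. 1 (1); [Lang1990] Ch. 13 §4 Lemma 4.1;
[Washington1997] §13.1; [Marcus1977] Ch. 5 Thm. 35–37; [Cohen1993] §6.3; [Lim2017FineSelmer] §3; cell files `eng2/fukuda269/{TABLE,LAYERS}-…-E2-v1.tsv`.
-/

set_option autoImplicit false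
-- sibling precedent (`…MuTwoKernelRowsA.lean`): the directory name repeats the summit name
set_option linter.dupNamespace false

noncomputable section
open scoped Classical IntermediateField NumberField Real nonZeroDivisors
namespace Summit.BirchSwinnertonDyer.BirchSwinnertonDyer.Theorems.AddKatoTwo
open WeierstrassCurve Field Polynomial IsDedekindDomain NumberField Matrix Literature.NumberTheory.EllipticCurves
  Literature.NumberTheory.GaloisRepresentations
  Literature.NumberTheory.IwasawaTheory
  Summit.BirchSwinnertonDyer.BirchSwinnertonDyer.Theorems.SteinbergFibreAtTwo
  Summit.BirchSwinnertonDyer.BirchSwinnertonDyer.Theorems.AlignedTransportAtTwoTorsionPointField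
  Summit.BirchSwinnertonDyer.BirchSwinnertonDyer.Theses.ByReductionTypeAtTwo

/-! ## The cubic field of discriminant `-5960` (`X³ + (-1)X² + (-6)X + (-14)`, index `1`; C4″ rows 333760ct1) -/

/-- `X³ + (-1)X² + (-6)X + (-14)` is irreducible over `ℚ` (no root mod `3`). -/
theorem irreducible_cubic_d5960n : Irreducible (Cubic.toPoly ⟨1, ((-1 : ℤ) : ℚ), ((-6 : ℤ) : ℚ), ((-14 : ℤ) : ℚ)⟩) :=
  haveI : Fact (Nat.Prime 3) := ⟨by norm_num⟩
  irreducible_cubic_of_no_root_zmod 3 (by decide)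

section Certd5960n

variable (K : Type) [Field K] [NumberField K]

/-- **`h` is ODD for every cubic number field whose integers contain a root `θ` of `X³ + (-1)X² + (-6)X + (-14)`** (`|disc| = 5960` = `|d_K|`,
`M_K < 22`): a norm certificate — for every prime `ℓ < 22` and every root `a` of the cubic mod `ℓ` a generator `x + yθ + zθ² ∈ ℤ[θ]` of norm `±ℓ`
of the ideal `I ∋ ℓ, θ − a` (coordinates `(x, y, z)`: `ℓ = 2`: `a = 0` ↦ `(-244, -171, -64)`, `a = 1` ↦ `(3477, 2437, 912)`; `ℓ = 3`: no root; `ℓ = 5`: `a = 1` ↦ `(-23, -16, -6)`, `a = 4` ↦ `(-157, -16, 16)`; `ℓ = 7`: `a = 0` ↦ `(49, -6, -2)`, `a = 3` ↦ `(229, 180, -66)`, `a = 5` ↦ `(-5, -17, 5)`; `ℓ = 11`: `a = 2` ↦ `(-103, -5, 9)`; `ℓ = 13`: `a = 6` ↦ `(-1117, -265, 155)`; `ℓ = 17`: `a = 7` ↦ `(-5, -6, 2)`; `ℓ = 19`: no root); found by the seat's relation sieve and CHECKED HERE by the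
kernel (`pow_three_eq_span_of_cert`, `Or.inl`). eng-2's PARI value (bnfcertify): `h = 1`. KERNEL. [cite: Marcus1977, Ch. 5 Thm. 35–37 and Cor. 2] [cite: Cohen1993, §6.3] -/
theorem odd_classNumber_of_root_d5960n (h3 : Module.finrank ℚ K = 3) (b : 𝓞 K)
    (hb : b ^ 3 + (-1 : ℤ) * b ^ 2 + (-6 : ℤ) * b + (-14 : ℤ) = 0) : Odd (NumberField.classNumber K) := by
  have hirr := irreducible_cubic_d5960n
  have hd : |NumberField.discr K| ≤ (5960 : ℕ) :=
    (abs_discr_le_abs_cubic_discr K h3 b hirr hb).trans (by simp only [Cubic.discr]; norm_num)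
  refine odd_classNumber_of_cubeCertificate K h3 (B := 22)
    (minkowskiBound_lt_of_sqrt_le K h3 hd (s := 77.21)
      ((Real.sqrt_le_sqrt (by norm_num : ((5960 : ℕ) : ℝ) ≤ (77.21 : ℝ) ^ 2)).trans (Real.sqrt_sq (by norm_num)).le)
      (by norm_num)) ?_
  intro ℓ hℓB hℓ J hJ
  interval_cases ℓ <;> norm_num at hℓ
  · -- `ℓ = 2`: roots [0, 1]
    refine pow_three_eq_span_of_cert K h3 b hirr hb (by norm_num) (fun a ha hdvd => ?_) hJ
    interval_cases a <;> norm_num at hdvd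
    · exact Or.inl ⟨(-244), (-171), (-64), 1, by norm_num, by norm_num, ⟨_, by rw [Nat.cast_one, one_mul]⟩, by norm_num⟩
    · exact Or.inl ⟨(3477), (2437), (912), 1, by norm_num, by norm_num, ⟨_, by rw [Nat.cast_one, one_mul]⟩, by norm_num⟩
  · -- `ℓ = 3`: roots []
    refine pow_three_eq_span_of_cert K h3 b hirr hb (by norm_num) (fun a ha hdvd => ?_) hJ
    interval_cases a <;> norm_num at hdvd
  · -- `ℓ = 5`: roots [1, 4]
    refine pow_three_eq_span_of_cert K h3 b hirr hb (by norm_num) (fun a ha hdvd => ?_) hJ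
    interval_cases a <;> norm_num at hdvd
    · exact Or.inl ⟨(-23), (-16), (-6), 1, by norm_num, by norm_num, ⟨_, by rw [Nat.cast_one, one_mul]⟩, by norm_num⟩
    · exact Or.inl ⟨(-157), (-16), (16), 1, by norm_num, by norm_num, ⟨_, by rw [Nat.cast_one, one_mul]⟩, by norm_num⟩
  · -- `ℓ = 7`: roots [0, 3, 5]
    refine pow_three_eq_span_of_cert K h3 b hirr hb (by norm_num) (fun a ha hdvd => ?_) hJ
    interval_cases a <;> norm_num at hdvd
    · exact Or.inl ⟨(49), (-6), (-2), 1, by norm_num, by norm_num, ⟨_, by rw [Nat.cast_one, one_mul]⟩, by norm_num⟩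
    · exact Or.inl ⟨(229), (180), (-66), 1, by norm_num, by norm_num, ⟨_, by rw [Nat.cast_one, one_mul]⟩, by norm_num⟩
    · exact Or.inl ⟨(-5), (-17), (5), 1, by norm_num, by norm_num, ⟨_, by rw [Nat.cast_one, one_mul]⟩, by norm_num⟩
  · -- `ℓ = 11`: roots [2]
    refine pow_three_eq_span_of_cert K h3 b hirr hb (by norm_num) (fun a ha hdvd => ?_) hJ
    interval_cases a <;> norm_num at hdvd
    · exact Or.inl ⟨(-103), (-5), (9), 1, by norm_num, by norm_num, ⟨_, by rw [Nat.cast_one, one_mul]⟩, by norm_num⟩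
  · -- `ℓ = 13`: roots [6]
    refine pow_three_eq_span_of_cert K h3 b hirr hb (by norm_num) (fun a ha hdvd => ?_) hJ
    interval_cases a <;> norm_num at hdvd
    · exact Or.inl ⟨(-1117), (-265), (155), 1, by norm_num, by norm_num, ⟨_, by rw [Nat.cast_one, one_mul]⟩, by norm_num⟩
  · -- `ℓ = 17`: roots [7]
    refine pow_three_eq_span_of_cert K h3 b hirr hb (by norm_num) (fun a ha hdvd => ?_) hJ
    interval_cases a <;> norm_num at hdvd
    · exact Or.inl ⟨(-5), (-6), (2), 1, by norm_num, by norm_num, ⟨_, by rw [Nat.cast_one, one_mul]⟩, by norm_num⟩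
  · -- `ℓ = 19`: roots []
    refine pow_three_eq_span_of_cert K h3 b hirr hb (by norm_num) (fun a ha hdvd => ?_) hJ
    interval_cases a <;> norm_num at hdvd

end Certd5960n

/-- **Iwasawa's `μ₂ = 0` for the cubic field of discriminant `-5960`** (`ℚ(θ)`, `θ³ + (-1)θ² + (-6)θ + (-14) = 0`; TWO primes above `2`,
`2 = 𝔭𝔮²`; `h` odd), KERNEL — every cyclotomic `ℤ₂`-extension of `ℚ(θ)` has `μ = 0` (growth form; indeed `e_n = 0` for all `n`).
Chevalley's door at `2` (k4-w1 `layerOneBit_of_chevalleyCert`): the unit `ε = (-5232981795) + (-3667755147)θ + (-1372589641)θ²` (regulator ≈ 24.34;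
`ε³ + (37210365865)ε² + (363773)ε + (1) = 0`) has `ε ≡ 5 (mod 8)` under `θ ↦ z₂ ≡ 5` (`8 ∣ g(5)`, `g'(5)` odd), so `(ε, 2)_𝔭 = −1`: a non-norm
from `ℚ(θ, √2)`, whence `e₁ = 0`; `≤ 2` primes above `2` by `4 ∤ g(0)`, `4 ∤ g(3)`; `e₀ = 0` by `odd_classNumber_of_root_d5960n`; `n₀ = 0` by an even-index certificate `u, v, m, m'` (`u² − 2v² = 4m`, `m² = 2m'`, `8 ∤ N(2 − m'³)`; `classicalMuVanishes_two_adjoin_of_evenIndexCertificate`); Fukuda 1994 Thm. 1 (1) (`_holds`).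
The (I1M′) input of GEN 9's door for the C4″ rows 333760ct1. [cite: Fukuda1994, Thm. 1 (1), p. 264] [cite: Lang1990, Ch. 13 §4, Lemma 4.1]
[cite: Washington1997, §13.1] [cite: Greenberg2001IwasawaPastPresent, §4 (Iwasawa's μ-conjecture)] -/
theorem classicalMu_two_cubicField_d5960n {θ : AlgebraicClosure ℚ} (hθ : aeval θ (Cubic.toPoly ⟨1, ((-1 : ℤ) : ℚ), ((-6 : ℤ) : ℚ), ((-14 : ℤ) : ℚ)⟩) = 0) :
    haveI : FiniteDimensional ℚ (IntermediateField.adjoin ℚ {θ}) :=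
      IntermediateField.adjoin.finiteDimensional ((AlgebraicClosure.isAlgebraic ℚ).isAlgebraic θ).isIntegral
    haveI : NumberField (IntermediateField.adjoin ℚ {θ}) := NumberField.mk
    ∀ κL : ZpExtension (IntermediateField.adjoin ℚ {θ}) 2, κL.IsCyclotomic → ClassicalMuVanishes κL := by
  intro κL hκL
  have hθ' : θ ^ 3 + (-1 : AlgebraicClosure ℚ) * θ ^ 2 + (-6 : AlgebraicClosure ℚ) * θ + (-14 : AlgebraicClosure ℚ) = 0 := by
    have := hθ
    simp only [Cubic.toPoly, map_one, one_mul, aeval_add, aeval_mul, aeval_C, aeval_X_pow, aeval_X,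
      eq_ratCast, Rat.cast_intCast] at this
    push_cast at this
    linear_combination this
  have he : aeval (algebraMap ℚ (AlgebraicClosure ℚ) (((-5232981795 : ℤ) : ℚ) / ((1 : ℤ) : ℚ)) +
      algebraMap ℚ (AlgebraicClosure ℚ) (((-3667755147 : ℤ) : ℚ) / ((1 : ℤ) : ℚ)) * θ +
      algebraMap ℚ (AlgebraicClosure ℚ) (((-1372589641 : ℤ) : ℚ) / ((1 : ℤ) : ℚ)) * θ ^ 2)
      (Cubic.toPoly ⟨1, ((37210365865 : ℤ) : ℚ), ((363773 : ℤ) : ℚ), ((1 : ℤ) : ℚ)⟩) = 0 := by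
    simp only [Cubic.toPoly, map_one, one_mul, aeval_add, aeval_mul, aeval_C, aeval_X_pow, aeval_X, eq_ratCast,
      Rat.cast_intCast, Rat.cast_div]
    push_cast
    linear_combination ((-62547988148828950921292544944 : AlgebraicClosure ℚ) + (-53698335210927246009155277795 : AlgebraicClosure ℚ) * θ + (-23316139718407794189069983242 : AlgebraicClosure ℚ) * θ ^ 2 + (-2585962071593946878569101721 : AlgebraicClosure ℚ) * θ ^ 3) * hθ'
  have hh := not_two_dvd_card_classGroup_adjoin_of_forall_cubicField_odd irreducible_cubic_d5960n (odd_classNumber_of_root_d5960n) hθ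
  have h1 := layerOneBit_of_chevalleyCert irreducible_cubic_d5960n hθ hh ⟨0, by norm_num⟩ ⟨1, by norm_num⟩
      (-5232981795) (-3667755147) (-1372589641) (1) (37210365865) (363773) (1) (by norm_num) he (5) (1) (by norm_num) (by norm_num) (by decide) (by decide)
  have hirr := irreducible_cubic_d5960n
  haveI : FiniteDimensional ℚ (IntermediateField.adjoin ℚ {θ}) :=
    IntermediateField.adjoin.finiteDimensional ((AlgebraicClosure.isAlgebraic ℚ).isAlgebraic θ).isIntegral
  haveI : NumberField (IntermediateField.adjoin ℚ {θ}) := NumberField.mk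
  obtain ⟨B, -, hB⟩ := exists_ringOfIntegers_cubic_root (p := -1) (q := -6) (r := -14) hθ
  have h3 := finrank_adjoin_eq_three_of_irreducible hirr hθ
  refine classicalMuVanishes_two_adjoin_of_evenIndexCertificate (p := -1) (q := -6) (r := -14) hirr hθ
    (((0 : ℤ) : 𝓞 (IntermediateField.adjoin ℚ {θ})) + ((-1 : ℤ) : 𝓞 (IntermediateField.adjoin ℚ {θ})) * B + ((1 : ℤ) : 𝓞 (IntermediateField.adjoin ℚ {θ})) * B ^ 2) (((-1 : ℤ) : 𝓞 (IntermediateField.adjoin ℚ {θ})) + ((-1 : ℤ) : 𝓞 (IntermediateField.adjoin ℚ {θ})) * B + ((0 : ℤ) : 𝓞 (IntermediateField.adjoin ℚ {θ})) * B ^ 2) (((-4 : ℤ) : 𝓞 (IntermediateField.adjoin ℚ {θ})) + ((1 : ℤ) : 𝓞 (IntermediateField.adjoin ℚ {θ})) * B + ((1 : ℤ) : 𝓞 (IntermediateField.adjoin ℚ {θ})) * B ^ 2) (((29 : ℤ) : 𝓞 (IntermediateField.adjoin ℚ {θ})) + ((12 : ℤ) : 𝓞 (IntermediateField.adjoin ℚ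 {θ})) * B + ((1 : ℤ) : 𝓞 (IntermediateField.adjoin ℚ {θ})) * B ^ 2) ?_ ?_ ?_
    hh κL hκL (h1 κL hκL)
  · push_cast; linear_combination (((-1 : ℤ) : 𝓞 (IntermediateField.adjoin ℚ {θ})) + ((1 : ℤ) : 𝓞 (IntermediateField.adjoin ℚ {θ})) * B + ((0 : ℤ) : 𝓞 (IntermediateField.adjoin ℚ {θ})) * B ^ 2) * hB
  · push_cast; linear_combination (((3 : ℤ) : 𝓞 (IntermediateField.adjoin ℚ {θ})) + ((1 : ℤ) : 𝓞 (IntermediateField.adjoin ℚ {θ})) * B + ((0 : ℤ) : 𝓞 (IntermediateField.adjoin ℚ {θ})) * B ^ 2) * hB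
  · have hz : (2 : 𝓞 (IntermediateField.adjoin ℚ {θ})) - (((29 : ℤ) : 𝓞 (IntermediateField.adjoin ℚ {θ})) + ((12 : ℤ) : 𝓞 (IntermediateField.adjoin ℚ {θ})) * B + ((1 : ℤ) : 𝓞 (IntermediateField.adjoin ℚ {θ})) * B ^ 2) ^ 3 =
        ((-88983 : ℤ) : 𝓞 (IntermediateField.adjoin ℚ {θ})) + (-65828 : ℤ) * B + (-23555 : ℤ) * B ^ 2 := by
      push_cast; linear_combination (((-4614 : ℤ) : 𝓞 (IntermediateField.adjoin ℚ {θ})) + ((-562 : ℤ) : 𝓞 (IntermediateField.adjoin ℚ {θ})) * B + ((-37 : ℤ) : 𝓞 (IntermediateField.adjoin ℚ {θ})) * B ^ 2 + ((-1 : ℤ) : 𝓞 (IntermediateField.adjoin ℚ {θ})) * B ^ 3 + ((0 : ℤ) : 𝓞 (IntermediateField.adjoin ℚ {θ})) * B ^ 4) * hB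
    rw [hz]
    exact not_eight_dvd_norm_coords _ h3 B hirr hB (-88983) (-65828) (-23555) (N := -25119472641430)
      (by simp only [Matrix.one_fin_three, Matrix.det_fin_three, Matrix.add_apply, Matrix.smul_apply, sq, Matrix.mul_apply,
        Fin.sum_univ_three, Matrix.of_apply, Matrix.cons_val', Matrix.cons_val_zero, Matrix.cons_val_one, Matrix.cons_val_two,
        Matrix.head_cons, Matrix.tail_cons, Matrix.empty_val', Matrix.cons_val_fin_one, smul_eq_mul]; norm_num) (by norm_num)

/-! ### Row `333760ct1` (cubic field `d = -5960`) -/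

/-- The census cubic model of the C4″ row `333760ct1` (`y² = x³ + (0)x² + (-808492)x + (-279837136)`, addL2x GEN 13 `nst_census` a-invariants) is an elliptic curve. -/
theorem isElliptic_333760ct1' : (⟨0, ((0 : ℤ) : ℚ), 0, ((-808492 : ℤ) : ℚ), ((-279837136 : ℤ) : ℚ)⟩ : WeierstrassCurve ℚ).IsElliptic :=
  isElliptic_cubicModel _ _ _ (by simp only [Cubic.discr]; norm_num)

/-- **UNCONDITIONAL (A)₂ for the C4″ census curve `333760ct1` — ZERO hypotheses, ZERO named facts** (additive potentially multiplicative at `2`,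
irreducible `E[2]`, `Δ < 0`; `2`-torsion cubic field `ℚ(θ)`, `θ³ + (-1)θ² + (-6)θ + (-14) = 0`, `d = -5960`, `p q^2, F_q=Q2(sqrt-2)`, `h` odd). Coates–Sujatha's
statement (A) at `p = 2` for the cubic model `y² = x³ + (0)x² + (-808492)x + (-279837136)`: for every cyclotomic `ℤ₂`-extension of `ℚ` the dual fine Selmer group
over `ℚ_∞` is finitely generated over `ℤ₂` (`∃ γ D` currency). KERNEL: `classicalMu_two_cubicField_d5960n` above (μ₂(ℚ(θ)_cyc) = 0 for the field of `X³ + (-1)X² + (-6)X + (-14)`) ⟹ cruxlead-19573-w2's `ℓ = 2` ascent to the totally complex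
`ℚ(E[2]) = ℚ(θ, √d)` and kernel Lim 3.5@2 (`TotallyComplexMu.conjA_two_cubicModel_of_classicalMu_of_discr_neg`); the root `β = x(T)` of the curve's cubic is
`-302 + (152)θ + (58)θ²` and `ℚ(β) = ℚ(θ)`. This discharges the (I1M′) input of this row (GEN 9 `hAnaMI_negDisc_of_cubicFieldMu`) in the kernel;
it is statement (A), NOT BSD: BSD₂ for `333760ct1` is NOT proved by this. [cite: CoatesSujatha2005, Conj. A and Thm. 3.4]
[cite: Iwasawa1973MuInvariants, Thm. 2 and Thm. 3] [cite: Fukuda1994, Thm. 1 (1), p. 264] [cite: Lang1990, Ch. 13 §4, Lemma 4.1] -/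
theorem conjA_two_333760ct1' (κ : ZpExtension ℚ 2) (hκ : κ.IsCyclotomic) :
    haveI := isElliptic_333760ct1'
    ∃ (γ : absoluteGaloisGroup ℚ) (D : (⟨0, ((0 : ℤ) : ℚ), 0, ((-808492 : ℤ) : ℚ), ((-279837136 : ℤ) : ℚ)⟩ : WeierstrassCurve ℚ).FineSelmerDualData κ γ),
      Module.Finite ℤ_[2] (RestrictScalars ℤ_[2] (IwasawaAlgebra 2) D.X) := by
  haveI := isElliptic_333760ct1'
  obtain ⟨θ, hθ⟩ : ∃ θ : AlgebraicClosure ℚ, aeval θ (Cubic.toPoly ⟨1, ((-1 : ℤ) : ℚ), ((-6 : ℤ) : ℚ), ((-14 : ℤ) : ℚ)⟩) = 0 :=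
    IsAlgClosed.exists_aeval_eq_zero _ _ (by rw [Cubic.degree_of_a_ne_zero one_ne_zero]; norm_num)
  have hθ' : θ ^ 3 + (-1 : AlgebraicClosure ℚ) * θ ^ 2 + (-6 : AlgebraicClosure ℚ) * θ + (-14 : AlgebraicClosure ℚ) = 0 := by
    have := hθ
    simp only [Cubic.toPoly, map_one, one_mul, aeval_add, aeval_mul, aeval_C, aeval_X_pow, aeval_X,
      eq_ratCast, Rat.cast_intCast] at this
    push_cast at this
    linear_combination this
  set β : AlgebraicClosure ℚ := algebraMap ℚ (AlgebraicClosure ℚ) (-302 : ℚ) +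
      algebraMap ℚ (AlgebraicClosure ℚ) (152 : ℚ) * θ + algebraMap ℚ (AlgebraicClosure ℚ) (58 : ℚ) * θ ^ 2 with hβdef
  have hβ : aeval β (Cubic.toPoly ⟨1, ((0 : ℤ) : ℚ), ((-808492 : ℤ) : ℚ), ((-279837136 : ℤ) : ℚ)⟩) = 0 := by
    simp only [Cubic.toPoly, map_one, one_mul, aeval_add, aeval_mul, aeval_C, aeval_X_pow, aeval_X, eq_ratCast,
      Rat.cast_intCast]
    rw [hβdef]
    simp only [eq_ratCast]
    push_cast
    linear_combination ((4515440 : AlgebraicClosure ℚ) + (3872080 : AlgebraicClosure ℚ) * θ + (1729096 : AlgebraicClosure ℚ) * θ ^ 2 + (195112 : AlgebraicClosure ℚ) * θ ^ 3) * hθ'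
  have hadj : IntermediateField.adjoin ℚ {β} = IntermediateField.adjoin ℚ {θ} := by
    apply le_antisymm
    · rw [IntermediateField.adjoin_simple_le_iff, hβdef]
      have hθmem := IntermediateField.mem_adjoin_simple_self ℚ θ
      exact add_mem (add_mem (algebraMap_mem _ _) (mul_mem (algebraMap_mem _ _) hθmem))
        (mul_mem (algebraMap_mem _ _) (pow_mem hθmem 2))
    · rw [IntermediateField.adjoin_simple_le_iff]
      have hθeq : θ = algebraMap ℚ (AlgebraicClosure ℚ) (-1948293/16688 : ℚ) +
          algebraMap ℚ (AlgebraicClosure ℚ) (-7313/66752 : ℚ) * β +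
          algebraMap ℚ (AlgebraicClosure ℚ) (29/133504 : ℚ) * β ^ 2 := by
        rw [hβdef]; simp only [eq_ratCast]; push_cast
        linear_combination (((-152221 : AlgebraicClosure ℚ) / 33376) + ((-24389 : AlgebraicClosure ℚ) / 33376) * θ) * hθ'
      rw [hθeq]
      have hβmem := IntermediateField.mem_adjoin_simple_self ℚ β
      exact add_mem (add_mem (algebraMap_mem _ _) (mul_mem (algebraMap_mem _ _) hβmem))
        (mul_mem (algebraMap_mem _ _) (pow_mem hβmem 2))
  have h3 : Module.finrank ℚ (IntermediateField.adjoin ℚ {β}) = 3 := by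
    rw [hadj]; exact finrank_adjoin_eq_three_of_irreducible irreducible_cubic_d5960n hθ
  exact TotallyComplexMu.conjA_two_cubicModel_of_classicalMu_of_discr_neg (0) (-808492) (-279837136)
    (irreducible_cubic_of_finrank_adjoin_eq_three hβ h3) (by simp only [Cubic.discr]; norm_num) hβ
    (by rw [hadj]; exact classicalMu_two_cubicField_d5960n hθ) κ hκ

/-! ## The cubic field of discriminant `-4232` — odd-index generator `X³ + (-25)X² + (-14)X + (-2)` (`[𝓞 : ℤ[θ]]` = 1; eng-2's polredabs cubic
`X³ + (-1)X² + (-15)X + (-29)` has index `2`, so the certificates use `θ = (5/2) + (2)·θ₀ + (1/2)·θ₀²` instead); C4″ rows 296240dt1 -/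

/-- `X³ + (-25)X² + (-14)X + (-2)` is irreducible over `ℚ` (no root mod `3`). -/
theorem irreducible_cubic_d4232n : Irreducible (Cubic.toPoly ⟨1, ((-25 : ℤ) : ℚ), ((-14 : ℤ) : ℚ), ((-2 : ℤ) : ℚ)⟩) :=
  haveI : Fact (Nat.Prime 3) := ⟨by norm_num⟩
  irreducible_cubic_of_no_root_zmod 3 (by decide)

section Certd4232n

variable (K : Type) [Field K] [NumberField K]

/-- **`h` is ODD for every cubic number field whose integers contain a root `θ` of `X³ + (-25)X² + (-14)X + (-2)`** (`|disc| = 4232` = `|d_K|`,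
`M_K < 19`): a norm certificate — for every prime `ℓ < 19` and every root `a` of the cubic mod `ℓ` a generator `x + yθ + zθ² ∈ ℤ[θ]` of norm `±ℓ`
of the ideal `I ∋ ℓ, θ − a` (coordinates `(x, y, z)`: `ℓ = 2`: `a = 0` ↦ `(0, -1, 0)`, `a = 1` ↦ `(-3, -21, -38)`; `ℓ = 3`: no root; `ℓ = 5`: `a = 1` ↦ `(-1, -4, 0)`; `ℓ = 7`: `a = 6` ↦ `(-1, -7, -13)`; `ℓ = 11`: `a = 3` ↦ `(-901896319, -3136289579, 124127785)`, `a = 5` ↦ `(-1, -2, 0)`, `a = 6` ↦ `(-7, -25, 1)`; `ℓ = 13`: `a = 5` ↦ `(-1612429125, -6699094660, 264655172)`; `ℓ = 17`: no root); found by the seat's relation sieve and CHECKED HERE by the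
kernel (`pow_three_eq_span_of_cert`, `Or.inl`). eng-2's PARI value (bnfcertify): `h = 1`. KERNEL. [cite: Marcus1977, Ch. 5 Thm. 35–37 and Cor. 2] [cite: Cohen1993, §6.3] -/
theorem odd_classNumber_of_root_d4232n (h3 : Module.finrank ℚ K = 3) (b : 𝓞 K)
    (hb : b ^ 3 + (-25 : ℤ) * b ^ 2 + (-14 : ℤ) * b + (-2 : ℤ) = 0) : Odd (NumberField.classNumber K) := by
  have hirr := irreducible_cubic_d4232n
  have hd : |NumberField.discr K| ≤ (4232 : ℕ) :=
    (abs_discr_le_abs_cubic_discr K h3 b hirr hb).trans (by simp only [Cubic.discr]; norm_num)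
  refine odd_classNumber_of_cubeCertificate K h3 (B := 19)
    (minkowskiBound_lt_of_sqrt_le K h3 hd (s := 65.06)
      ((Real.sqrt_le_sqrt (by norm_num : ((4232 : ℕ) : ℝ) ≤ (65.06 : ℝ) ^ 2)).trans (Real.sqrt_sq (by norm_num)).le)
      (by norm_num)) ?_
  intro ℓ hℓB hℓ J hJ
  interval_cases ℓ <;> norm_num at hℓ
  · -- `ℓ = 2`: roots [0, 1]
    refine pow_three_eq_span_of_cert K h3 b hirr hb (by norm_num) (fun a ha hdvd => ?_) hJ
    interval_cases a <;> norm_num at hdvd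
    · exact Or.inl ⟨(0), (-1), (0), 1, by norm_num, by norm_num, ⟨_, by rw [Nat.cast_one, one_mul]⟩, by norm_num⟩
    · exact Or.inl ⟨(-3), (-21), (-38), 1, by norm_num, by norm_num, ⟨_, by rw [Nat.cast_one, one_mul]⟩, by norm_num⟩
  · -- `ℓ = 3`: roots []
    refine pow_three_eq_span_of_cert K h3 b hirr hb (by norm_num) (fun a ha hdvd => ?_) hJ
    interval_cases a <;> norm_num at hdvd
  · -- `ℓ = 5`: roots [1]
    refine pow_three_eq_span_of_cert K h3 b hirr hb (by norm_num) (fun a ha hdvd => ?_) hJ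
    interval_cases a <;> norm_num at hdvd
    · exact Or.inl ⟨(-1), (-4), (0), 1, by norm_num, by norm_num, ⟨_, by rw [Nat.cast_one, one_mul]⟩, by norm_num⟩
  · -- `ℓ = 7`: roots [6]
    refine pow_three_eq_span_of_cert K h3 b hirr hb (by norm_num) (fun a ha hdvd => ?_) hJ
    interval_cases a <;> norm_num at hdvd
    · exact Or.inl ⟨(-1), (-7), (-13), 1, by norm_num, by norm_num, ⟨_, by rw [Nat.cast_one, one_mul]⟩, by norm_num⟩
  · -- `ℓ = 11`: roots [3, 5, 6]
    refine pow_three_eq_span_of_cert K h3 b hirr hb (by norm_num) (fun a ha hdvd => ?_) hJ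
    interval_cases a <;> norm_num at hdvd
    · exact Or.inl ⟨(-901896319), (-3136289579), (124127785), 1, by norm_num, by norm_num, ⟨_, by rw [Nat.cast_one, one_mul]⟩, by norm_num⟩
    · exact Or.inl ⟨(-1), (-2), (0), 1, by norm_num, by norm_num, ⟨_, by rw [Nat.cast_one, one_mul]⟩, by norm_num⟩
    · exact Or.inl ⟨(-7), (-25), (1), 1, by norm_num, by norm_num, ⟨_, by rw [Nat.cast_one, one_mul]⟩, by norm_num⟩
  · -- `ℓ = 13`: roots [5]
    refine pow_three_eq_span_of_cert K h3 b hirr hb (by norm_num) (fun a ha hdvd => ?_) hJ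
    interval_cases a <;> norm_num at hdvd
    · exact Or.inl ⟨(-1612429125), (-6699094660), (264655172), 1, by norm_num, by norm_num, ⟨_, by rw [Nat.cast_one, one_mul]⟩, by norm_num⟩
  · -- `ℓ = 17`: roots []
    refine pow_three_eq_span_of_cert K h3 b hirr hb (by norm_num) (fun a ha hdvd => ?_) hJ
    interval_cases a <;> norm_num at hdvd

end Certd4232n

/-- **Iwasawa's `μ₂ = 0` for the cubic field of discriminant `-4232`** (`ℚ(θ)`, `θ³ + (-25)θ² + (-14)θ + (-2) = 0`; TWO primes above `2`,
`2 = 𝔭𝔮²`; `h` odd), KERNEL — every cyclotomic `ℤ₂`-extension of `ℚ(θ)` has `μ = 0` (growth form; indeed `e_n = 0` for all `n`).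
Chevalley's door at `2` (k4-w1 `layerOneBit_of_chevalleyCert`): the unit `ε = (-971) + (-6835)θ + (-12405)θ²` (regulator ≈ 15.93;
`ε³ + (8274253)ε² + (5753)ε + (1) = 0`) has `ε ≡ 5 (mod 8)` under `θ ↦ z₂ ≡ 1` (`8 ∣ g(1)`, `g'(1)` odd), so `(ε, 2)_𝔭 = −1`: a non-norm
from `ℚ(θ, √2)`, whence `e₁ = 0`; `≤ 2` primes above `2` by `4 ∤ g(0)`, `4 ∤ g(3)`; `e₀ = 0` by `odd_classNumber_of_root_d4232n`; `n₀ = 0` by an even-index certificate `u, v, m, m'` (`u² − 2v² = 4m`, `m² = 2m'`, `8 ∤ N(2 − m'³)`; `classicalMuVanishes_two_adjoin_of_evenIndexCertificate`); Fukuda 1994 Thm. 1 (1) (`_holds`).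
The (I1M′) input of GEN 9's door for the C4″ rows 296240dt1. [cite: Fukuda1994, Thm. 1 (1), p. 264] [cite: Lang1990, Ch. 13 §4, Lemma 4.1]
[cite: Washington1997, §13.1] [cite: Greenberg2001IwasawaPastPresent, §4 (Iwasawa's μ-conjecture)] -/
theorem classicalMu_two_cubicField_d4232n {θ : AlgebraicClosure ℚ} (hθ : aeval θ (Cubic.toPoly ⟨1, ((-25 : ℤ) : ℚ), ((-14 : ℤ) : ℚ), ((-2 : ℤ) : ℚ)⟩) = 0) :
    haveI : FiniteDimensional ℚ (IntermediateField.adjoin ℚ {θ}) :=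
      IntermediateField.adjoin.finiteDimensional ((AlgebraicClosure.isAlgebraic ℚ).isAlgebraic θ).isIntegral
    haveI : NumberField (IntermediateField.adjoin ℚ {θ}) := NumberField.mk
    ∀ κL : ZpExtension (IntermediateField.adjoin ℚ {θ}) 2, κL.IsCyclotomic → ClassicalMuVanishes κL := by
  intro κL hκL
  have hθ' : θ ^ 3 + (-25 : AlgebraicClosure ℚ) * θ ^ 2 + (-14 : AlgebraicClosure ℚ) * θ + (-2 : AlgebraicClosure ℚ) = 0 := by
    have := hθ
    simp only [Cubic.toPoly, map_one, one_mul, aeval_add, aeval_mul, aeval_C, aeval_X_pow, aeval_X,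
      eq_ratCast, Rat.cast_intCast] at this
    push_cast at this
    linear_combination this
  have he : aeval (algebraMap ℚ (AlgebraicClosure ℚ) (((-971 : ℤ) : ℚ) / ((1 : ℤ) : ℚ)) +
      algebraMap ℚ (AlgebraicClosure ℚ) (((-6835 : ℤ) : ℚ) / ((1 : ℤ) : ℚ)) * θ +
      algebraMap ℚ (AlgebraicClosure ℚ) (((-12405 : ℤ) : ℚ) / ((1 : ℤ) : ℚ)) * θ ^ 2)
      (Cubic.toPoly ⟨1, ((8274253 : ℤ) : ℚ), ((5753 : ℤ) : ℚ), ((1 : ℤ) : ℚ)⟩) = 0 := by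
    simp only [Cubic.toPoly, map_one, one_mul, aeval_add, aeval_mul, aeval_C, aeval_X_pow, aeval_X, eq_ratCast,
      Rat.cast_intCast, Rat.cast_div]
    push_cast
    linear_combination ((-3900191944000 : AlgebraicClosure ℚ) + (-27603408450375 : AlgebraicClosure ℚ) * θ + (-50878675185750 : AlgebraicClosure ℚ) * θ ^ 2 + (-1908931330125 : AlgebraicClosure ℚ) * θ ^ 3) * hθ'
  have hh := not_two_dvd_card_classGroup_adjoin_of_forall_cubicField_odd irreducible_cubic_d4232n (odd_classNumber_of_root_d4232n) hθ
  have h1 := layerOneBit_of_chevalleyCert irreducible_cubic_d4232n hθ hh ⟨0, by norm_num⟩ ⟨1, by norm_num⟩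
      (-971) (-6835) (-12405) (1) (8274253) (5753) (1) (by norm_num) he (1) (1) (by norm_num) (by norm_num) (by decide) (by decide)
  have hirr := irreducible_cubic_d4232n
  haveI : FiniteDimensional ℚ (IntermediateField.adjoin ℚ {θ}) :=
    IntermediateField.adjoin.finiteDimensional ((AlgebraicClosure.isAlgebraic ℚ).isAlgebraic θ).isIntegral
  haveI : NumberField (IntermediateField.adjoin ℚ {θ}) := NumberField.mk
  obtain ⟨B, -, hB⟩ := exists_ringOfIntegers_cubic_root (p := -25) (q := -14) (r := -2) hθ
  have h3 := finrank_adjoin_eq_three_of_irreducible hirr hθ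
  refine classicalMuVanishes_two_adjoin_of_evenIndexCertificate (p := -25) (q := -14) (r := -2) hirr hθ
    (((0 : ℤ) : 𝓞 (IntermediateField.adjoin ℚ {θ})) + ((-1 : ℤ) : 𝓞 (IntermediateField.adjoin ℚ {θ})) * B + ((1 : ℤ) : 𝓞 (IntermediateField.adjoin ℚ {θ})) * B ^ 2) (((-1 : ℤ) : 𝓞 (IntermediateField.adjoin ℚ {θ})) + ((0 : ℤ) : 𝓞 (IntermediateField.adjoin ℚ {θ})) * B + ((-1 : ℤ) : 𝓞 (IntermediateField.adjoin ℚ {θ})) * B ^ 2) (((-14 : ℤ) : 𝓞 (IntermediateField.adjoin ℚ {θ})) + ((-95 : ℤ) : 𝓞 (IntermediateField.adjoin ℚ {θ})) * B + ((-173 : ℤ) : 𝓞 (IntermediateField.adjoin ℚ {θ})) * B ^ 2) (((781193 : ℤ) : 𝓞 (IntermediateField.adjoin ℚ {θ})) + ((5498924 : ℤ) : 𝓞 (IntermediateField.adjoin ℚ {θ})) * B + ((9980125 : ℤ) : 𝓞 (IntermediateField.adjoin ℚ {θ})) * B ^ 2) ?_ ?_ ?_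
    hh κL hκL (h1 κL hκL)
  · push_cast; linear_combination (((-27 : ℤ) : 𝓞 (IntermediateField.adjoin ℚ {θ})) + ((-1 : ℤ) : 𝓞 (IntermediateField.adjoin ℚ {θ})) * B + ((0 : ℤ) : 𝓞 (IntermediateField.adjoin ℚ {θ})) * B ^ 2) * hB
  · push_cast; linear_combination (((781095 : ℤ) : 𝓞 (IntermediateField.adjoin ℚ {θ})) + ((29929 : ℤ) : 𝓞 (IntermediateField.adjoin ℚ {θ})) * B + ((0 : ℤ) : 𝓞 (IntermediateField.adjoin ℚ {θ})) * B ^ 2) * hB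
  · have hz : (2 : 𝓞 (IntermediateField.adjoin ℚ {θ})) - (((781193 : ℤ) : 𝓞 (IntermediateField.adjoin ℚ {θ})) + ((5498924 : ℤ) : 𝓞 (IntermediateField.adjoin ℚ {θ})) * B + ((9980125 : ℤ) : 𝓞 (IntermediateField.adjoin ℚ {θ})) * B ^ 2) ^ 3 =
        ((-34617388537168741281492603 : ℤ) : 𝓞 (IntermediateField.adjoin ℚ {θ})) + (-243676555401273664430562564 : ℤ) * B + (-442254230988121177711208279 : ℤ) * B ^ 2 := by
      push_cast; linear_combination (((-17308694030217972790448274 : ℤ) : 𝓞 (IntermediateField.adjoin ℚ {θ})) + ((-677414455430334558137250 : ℤ) : 𝓞 (IntermediateField.adjoin ℚ {θ})) * B + ((-26494359815058063390625 : ℤ) : 𝓞 (IntermediateField.adjoin ℚ {θ})) * B ^ 2 + ((-994049342617814453125 : ℤ) : 𝓞 (IntermediateField.adjoin ℚ {θ})) * B ^ 3 + ((0 : ℤ) : 𝓞 (IntermediateField.adjoin ℚ {θ})) * B ^ 4) * hB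
    rw [hz]
    exact not_eight_dvd_norm_coords _ h3 B hirr hB (-34617388537168741281492603) (-243676555401273664430562564) (-442254230988121177711208279) (N := -1176058913536558125761696578550)
      (by simp only [Matrix.one_fin_three, Matrix.det_fin_three, Matrix.add_apply, Matrix.smul_apply, sq, Matrix.mul_apply,
        Fin.sum_univ_three, Matrix.of_apply, Matrix.cons_val', Matrix.cons_val_zero, Matrix.cons_val_one, Matrix.cons_val_two,
        Matrix.head_cons, Matrix.tail_cons, Matrix.empty_val', Matrix.cons_val_fin_one, smul_eq_mul]; norm_num) (by norm_num)

/-! ### Row `296240dt1` (cubic field `d = -4232`) -/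

/-- The census cubic model of the C4″ row `296240dt1` (`y² = x³ + (0)x² + (-8078170147)x + (-328292741819614)`, addL2x GEN 13 `nst_census` a-invariants) is an elliptic curve. -/
theorem isElliptic_296240dt1' : (⟨0, ((0 : ℤ) : ℚ), 0, ((-8078170147 : ℤ) : ℚ), ((-328292741819614 : ℤ) : ℚ)⟩ : WeierstrassCurve ℚ).IsElliptic :=
  isElliptic_cubicModel _ _ _ (by simp only [Cubic.discr]; norm_num)

/-- **UNCONDITIONAL (A)₂ for the C4″ census curve `296240dt1` — ZERO hypotheses, ZERO named facts** (additive potentially multiplicative at `2`,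
irreducible `E[2]`, `Δ < 0`; `2`-torsion cubic field `ℚ(θ)`, `θ³ + (-25)θ² + (-14)θ + (-2) = 0`, `d = -4232`, `p q^2, F_q=Q2(sqrt-2)`, `h` odd). Coates–Sujatha's
statement (A) at `p = 2` for the cubic model `y² = x³ + (0)x² + (-8078170147)x + (-328292741819614)`: for every cyclotomic `ℤ₂`-extension of `ℚ` the dual fine Selmer group
over `ℚ_∞` is finitely generated over `ℤ₂` (`∃ γ D` currency). KERNEL: `classicalMu_two_cubicField_d4232n` above (μ₂(ℚ(θ)_cyc) = 0 for the field of `X³ + (-25)X² + (-14)X + (-2)`) ⟹ cruxlead-19573-w2's `ℓ = 2` ascent to the totally complex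
`ℚ(E[2]) = ℚ(θ, √d)` and kernel Lim 3.5@2 (`TotallyComplexMu.conjA_two_cubicModel_of_classicalMu_of_discr_neg`); the root `β = x(T)` of the curve's cubic is
`-151041 + (-352544)θ + (14191)θ²` and `ℚ(β) = ℚ(θ)`. This discharges the (I1M′) input of this row (GEN 9 `hAnaMI_negDisc_of_cubicFieldMu`) in the kernel;
it is statement (A), NOT BSD: BSD₂ for `296240dt1` is NOT proved by this. [cite: CoatesSujatha2005, Conj. A and Thm. 3.4]
[cite: Iwasawa1973MuInvariants, Thm. 2 and Thm. 3] [cite: Fukuda1994, Thm. 1 (1), p. 264] [cite: Lang1990, Ch. 13 §4, Lemma 4.1] -/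
theorem conjA_two_296240dt1' (κ : ZpExtension ℚ 2) (hκ : κ.IsCyclotomic) :
    haveI := isElliptic_296240dt1'
    ∃ (γ : absoluteGaloisGroup ℚ) (D : (⟨0, ((0 : ℤ) : ℚ), 0, ((-8078170147 : ℤ) : ℚ), ((-328292741819614 : ℤ) : ℚ)⟩ : WeierstrassCurve ℚ).FineSelmerDualData κ γ),
      Module.Finite ℤ_[2] (RestrictScalars ℤ_[2] (IwasawaAlgebra 2) D.X) := by
  haveI := isElliptic_296240dt1'
  obtain ⟨θ, hθ⟩ : ∃ θ : AlgebraicClosure ℚ, aeval θ (Cubic.toPoly ⟨1, ((-25 : ℤ) : ℚ), ((-14 : ℤ) : ℚ), ((-2 : ℤ) : ℚ)⟩) = 0 :=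
    IsAlgClosed.exists_aeval_eq_zero _ _ (by rw [Cubic.degree_of_a_ne_zero one_ne_zero]; norm_num)
  have hθ' : θ ^ 3 + (-25 : AlgebraicClosure ℚ) * θ ^ 2 + (-14 : AlgebraicClosure ℚ) * θ + (-2 : AlgebraicClosure ℚ) = 0 := by
    have := hθ
    simp only [Cubic.toPoly, map_one, one_mul, aeval_add, aeval_mul, aeval_C, aeval_X_pow, aeval_X,
      eq_ratCast, Rat.cast_intCast] at this
    push_cast at this
    linear_combination this
  set β : AlgebraicClosure ℚ := algebraMap ℚ (AlgebraicClosure ℚ) (-151041 : ℚ) +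
      algebraMap ℚ (AlgebraicClosure ℚ) (-352544 : ℚ) * θ + algebraMap ℚ (AlgebraicClosure ℚ) (14191 : ℚ) * θ ^ 2 with hβdef
  have hβ : aeval β (Cubic.toPoly ⟨1, ((0 : ℤ) : ℚ), ((-8078170147 : ℤ) : ℚ), ((-328292741819614 : ℤ) : ℚ)⟩) = 0 := by
    simp only [Cubic.toPoly, map_one, one_mul, aeval_add, aeval_mul, aeval_C, aeval_X_pow, aeval_X, eq_ratCast,
      Rat.cast_intCast]
    rw [hβdef]
    simp only [eq_ratCast]
    push_cast
    linear_combination ((1276957064604254 : AlgebraicClosure ℚ) + (1701427644269934 : AlgebraicClosure ℚ) * θ + (-141544492162217 : AlgebraicClosure ℚ) * θ ^ 2 + (2857847169871 : AlgebraicClosure ℚ) * θ ^ 3) * hθ'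
  have hadj : IntermediateField.adjoin ℚ {β} = IntermediateField.adjoin ℚ {θ} := by
    apply le_antisymm
    · rw [IntermediateField.adjoin_simple_le_iff, hβdef]
      have hθmem := IntermediateField.mem_adjoin_simple_self ℚ θ
      exact add_mem (add_mem (algebraMap_mem _ _) (mul_mem (algebraMap_mem _ _) hθmem))
        (mul_mem (algebraMap_mem _ _) (pow_mem hθmem 2))
    · rw [IntermediateField.adjoin_simple_le_iff]
      have hθeq : θ = algebraMap ℚ (AlgebraicClosure ℚ) (68334801/24586240 : ℚ) +
          algebraMap ℚ (AlgebraicClosure ℚ) (120201/1130967040 : ℚ) * β +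
          algebraMap ℚ (AlgebraicClosure ℚ) (617/598281564160 : ℚ) * β ^ 2 := by
        rw [hβdef]; simp only [eq_ratCast]; push_cast
        linear_combination (((5798274159 : AlgebraicClosure ℚ) / 1130967040) + ((-234885113 : AlgebraicClosure ℚ) / 1130967040) * θ) * hθ'
      rw [hθeq]
      have hβmem := IntermediateField.mem_adjoin_simple_self ℚ β
      exact add_mem (add_mem (algebraMap_mem _ _) (mul_mem (algebraMap_mem _ _) hβmem))
        (mul_mem (algebraMap_mem _ _) (pow_mem hβmem 2))
  have h3 : Module.finrank ℚ (IntermediateField.adjoin ℚ {β}) = 3 := by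
    rw [hadj]; exact finrank_adjoin_eq_three_of_irreducible irreducible_cubic_d4232n hθ
  exact TotallyComplexMu.conjA_two_cubicModel_of_classicalMu_of_discr_neg (0) (-8078170147) (-328292741819614)
    (irreducible_cubic_of_finrank_adjoin_eq_three hβ h3) (by simp only [Cubic.discr]; norm_num) hβ
    (by rw [hadj]; exact classicalMu_two_cubicField_d4232n hθ) κ hκ
end Summit.BirchSwinnertonDyer.BirchSwinnertonDyer.Theorems.AddKatoTwo

end
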